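import Literature.Probability.LatticeModels.DoubleCurrentsPercolation
import Literature.Probability.LatticeModels.DoubleCurrentsInsertion
import Literature.Probability.Percolation.LocalEventsComparison
import HarnessLib

/-!
# ADS15 Thm. 3.1 for the infinite-volume double current, without ergodicity or uniqueness

Trunk G02 (T-STATMECH), topic `Probability/LatticeModels`; namespaces `Literature.StatMech` (lemmas on
the limit measure) and `Literature.CritIsing` (the reductions of the named facts). Theorem-only file,
companion of `DoubleCurrentsPercolation.lean`. It proves the third named fact of
`DoubleCurrentsInfinite.lean` about the infinite-volume double random current
`ℙ_β = adsDoubleCurrentLawInf d β` of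

* M. Aizenman, H. Duminil-Copin, V. Sidoravicius, *Random currents and continuity of Ising
  model's spontaneous magnetization*, Comm. Math. Phys. **334** (2015) 719–742
  (arXiv:1311.1937v3 numbering; bib key `AizenmanDuminilCopinSidoraviciusCMP2015`, "ADS15"),
  Thm. 3.1: "For `β` at which `M̃_LRO(β) = 0`, also `ℙ_β[0 ↔ ∞] = 0`",

namely `ads_percolatesAt_zero_of_lroTildeSq`, **from the shift invariance R2
(`ads_doubleCurrent_shift_invariant`) alone** — `ads_percolatesAt_zero_of_lroTildeSq_of_shift_invariant`
— whereas `DoubleCurrentsPercolation.lean` (`ads_percolatesAt_zero_of_lroTildeSq_of_uniqueCluster`)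
takes in addition R1 and the uniqueness of the infinite cluster (ADS15 Thm. 2.5, which rests on
the ergodicity R3). With R1 and R2 theorems of the tree (`DoubleCurrentsLimit.lean`,
`DoubleCurrentsShift.lean`) this closes ADS15 Thm. 3.1 and the finite-volume fact
`ads_exitProb_tendsto_zero_of_lroTildeSq` of `DoubleCurrents.lean`
(`ads_exitProb_tendsto_zero_of_lroTildeSq_of_limit`; the unconditional forms are recorded in
`CriticalTwoPointBounds.lean`, which imports `DoubleCurrentsShift.lean`).

## The proof (ADS15 §3.1 with Lemma 2.6, and Thm. 2.5 weakened to "at most two infinite clusters")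

Let `μ` be a local limit of the box double currents `ℙ_{Λ_L,β}` (`IsAdsLimit d β μ`, `β > 0`)
invariant under the lattice translations. Then:

* **(S)** `μ`-a.s. only nearest-neighbour bonds are open (`IsAdsLimit.ae_subset_edgeSet`,
  `DoubleCurrentsPercolation.lean`);
* **(I) Lemma 2.6** "for every `N`, there is `c > 0` such that for every event `𝓔`,
  `ℙ_β[Φ̂_N(𝓔)] ≥ c ℙ_β[𝓔]`" (`Φ̂_N` = opening the bonds of `Λ_N`): box insertion tolerance of `μ`
  (`IsAdsLimit.box_insertion`), from the finite-volume statement uniform in `L`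
  (`adsDoubleCurrentLaw_box_insertion`, `DoubleCurrentsInsertion.lean`: "with a value which does
  not depend on `n > N`") passed to the limit on local events (R1; `Φ̂_N⁻¹` of a local event is
  local, `IsLocalEvent.preimage_openEdges`) and extended to all events by comparing the finite
  measures `c · μ ∘ Φ̂_N⁻¹` and `μ`, which are ordered on local events
  (`measure_le_of_forall_isLocalEvent_le`, `LocalEventsComparison.lean`);
* **(3.4)** `ℙ_β[x ↔ y] ≤ ⟨σ_xσ_y⟩⁰_β` (`IsAdsLimit.openConn_le_freePair`,
  `DoubleCurrentsPercolation.lean`, from (3.2)–(3.3) of `DoubleCurrentsConnection.lean`);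
* **(3.5) without uniqueness**: by (S), translation invariance and (I), `μ`-a.s. there are *at
  most two* infinite clusters — the half of the Burton–Keane argument that uses no ergodicity
  (`measure_threeInfClusters_eq_zero_of_invariant`) — which suffices for the density bound
  `ℙ_β[0 ↔ ∞]² ≤ 2|B|⁻² ∑_{x,y∈B} ℙ_β[x ↔ y] ≤ 2|B|⁻² ∑_{x,y∈B} ⟨σ_xσ_y⟩⁰_β`
  (`measure_percolatesAt_eq_zero_of_insertionTolerant`, `UniqueClusterDensityBound.lean`);
  taking the infimum over `B`, `M̃_LRO(β) = 0 ⇒ ℙ_β[0 ↔ ∞] = 0` (`IsAdsLimit.percolatesAt_eq_zero`).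

ADS15 prove Thm. 2.5 (a.s. *unique* infinite cluster) from R2, R3 and Lemma 2.6 and use `a² ≤ ∑`
for the unique cluster; the variant replaces uniqueness by "at most two" and `(a+b)² ≤ 2(a²+b²)`,
so that **neither R3 (ergodicity, ADS15 App. A) nor R1 is needed for Thm. 3.1** (if the local
limit does not exist, `ℙ_β` is the junk measure `0`). This is a deviation in the proof only; the
statements discharged are the tree's.

## Mathlib status

No random currents / dependent percolation in Mathlib. Anchors: `ENNReal.tendsto_ofReal`,
`ENNReal.Tendsto.const_mul`, `le_of_tendsto_of_tendsto'`, `MeasureTheory.Measure.map_apply`,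
`exists_lt_of_csInf_lt`; tree: `IsAdsLimit`, `adsDoubleCurrentLawInf`, `bondShift`,
`ads_exitProb_tendsto_zero_of_lroTildeSq_of_infinite` (`DoubleCurrentsInfinite.lean`),
`IsAdsLimit.ae_subset_edgeSet`, `IsAdsLimit.openConn_le_freePair`,
`measurePreserving_of_map_bondShift_eq` (`DoubleCurrentsPercolation.lean`),
`adsDoubleCurrentLaw_box_insertion` (`DoubleCurrentsInsertion.lean`),
`IsLocalEvent.preimage_openEdges`, `measure_le_of_forall_isLocalEvent_le`
(`LocalEventsComparison.lean`), `measure_percolatesAt_eq_zero_of_insertionTolerant`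
(`UniqueClusterDensityBound.lean`), `lroTildeSq`, `freeBlockAverage_def`, `lroTildeSq_set_nonempty`
(`MagnetizationContinuity.lean`).
-/

noncomputable section

open MeasureTheory Filter Topology Finset Literature.Probability.LatticeModels Literature.Probability.Percolation
open scoped ENNReal

namespace Literature.Probability.LatticeModels

variable {d : ℕ}

namespace IsAdsLimit

variable {β : ℝ} {μ : Measure (BondConfig (Site d))}

/-- R1 in `ℝ≥0∞`-form: for `β ≥ 0` (all laws are probability measures) the convergence of the
real probabilities of local events is the convergence of the measures of local events. [cite: AizenmanDuminilCopinSidoraviciusCMP2015, Thm. 2.3 (R1) and §2.3] -/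
theorem tendsto_measure (hβ : 0 ≤ β) (hμ : IsAdsLimit d β μ) {A : Set (BondConfig (Site d))}
    (hA : IsLocalEvent A) :
    Tendsto (fun L : ℕ => adsDoubleCurrentLaw d L β A) atTop (𝓝 (μ A)) := by
  haveI := hμ.isProbabilityMeasure
  haveI : ∀ L, IsProbabilityMeasure (adsDoubleCurrentLaw d L β) := fun L =>
    isProbabilityMeasure_adsDoubleCurrentLaw d L hβ
  have h := ENNReal.tendsto_ofReal (hμ.tendsto_local A hA)
  rw [ofReal_measureReal (measure_ne_top _ _)] at h
  exact h.congr fun L => ofReal_measureReal (measure_ne_top _ _)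

/-- **ADS15 Lemma 2.6 for the infinite-volume double current** ("for every `N`, there is `c > 0`
such that for every event `𝓔`, `ℙ_β[Φ̂_N(𝓔)] ≥ c ℙ_β[𝓔]`", `Φ̂_N` = opening the bonds of `Λ_N`),
in preimage form: `c · ℙ_β{ω : ω ∪ E(Λ_N) ∈ 𝓔} ≤ ℙ_β(𝓔)` for measurable `𝓔`, `β > 0`. From the
finite-volume statement uniform in `L` ("with a value which does not depend on `n > N`",
`adsDoubleCurrentLaw_box_insertion`) by R1 on local events, and extension to the σ-algebra by
comparison of finite measures on local events (`measure_le_of_forall_isLocalEvent_le`). [cite: AizenmanDuminilCopinSidoraviciusCMP2015, Lemma 2.6] -/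
theorem box_insertion (hβ : 0 < β) (hμ : IsAdsLimit d β μ) (N : ℕ) :
    ∃ c : ℝ, 0 < c ∧ ∀ E : Set (BondConfig (Site d)), MeasurableSet E →
      c * μ.real (openEdges ↑(edgesIn (zdGraph d) (box d N)) ⁻¹' E) ≤ μ.real E := by
  haveI := hμ.isProbabilityMeasure
  set F : Set (Sym2 (Site d)) := ↑(edgesIn (zdGraph d) (box d N)) with hFdef
  obtain ⟨c, hc0, hctop, hc⟩ := adsDoubleCurrentLaw_box_insertion (d := d) hβ N
  refine ⟨c.toReal, ENNReal.toReal_pos hc0 hctop, fun E hE => ?_⟩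
  -- on local events, by R1 along `L + N`
  have hloc : ∀ A : Set (BondConfig (Site d)), IsLocalEvent A → c * μ (openEdges F ⁻¹' A) ≤ μ A := by
    intro A hA
    have h1 : Tendsto (fun L : ℕ => c * adsDoubleCurrentLaw d (L + N) β (openEdges F ⁻¹' A)) atTop
        (𝓝 (c * μ (openEdges F ⁻¹' A))) :=
      ENNReal.Tendsto.const_mul
        ((hμ.tendsto_measure hβ.le (hA.preimage_openEdges F)).comp (tendsto_add_atTop_nat N)) (Or.inr hctop)
    have h2 : Tendsto (fun L : ℕ => adsDoubleCurrentLaw d (L + N) β A) atTop (𝓝 (μ A)) :=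
      (hμ.tendsto_measure hβ.le hA).comp (tendsto_add_atTop_nat N)
    exact le_of_tendsto_of_tendsto' h1 h2 fun L =>
      hc (L + N) (Nat.le_add_left _ _) A (measurableSet_of_isLocalEvent_holds hA)
  -- on all events: the finite measures `c • μ ∘ Φ̂_N⁻¹ ≤ μ` agree in order on local events
  set ν : Measure (BondConfig (Site d)) := c • μ.map (openEdges F) with hν
  haveI : IsFiniteMeasure (μ.map (openEdges F)) := Measure.isFiniteMeasure_map μ _
  haveI : IsFiniteMeasure ν := by
    refine ⟨?_⟩
    rw [hν, Measure.smul_apply, smul_eq_mul]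
    exact ENNReal.mul_lt_top hctop.lt_top (measure_lt_top _ _)
  have hνapply : ∀ A : Set (BondConfig (Site d)), MeasurableSet A → ν A = c * μ (openEdges F ⁻¹' A) := by
    intro A hA
    rw [hν, Measure.smul_apply, smul_eq_mul, Measure.map_apply (measurable_openEdges F) hA]
  have hle : ν E ≤ μ E :=
    measure_le_of_forall_isLocalEvent_le
      (fun A hA => (hνapply A (measurableSet_of_isLocalEvent_holds hA)) ▸ hloc A hA) hE
  rw [hνapply E hE] at hle
  rw [measureReal_def, measureReal_def, ← ENNReal.toReal_mul]
  exact ENNReal.toReal_mono (measure_ne_top _ _) hle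

/-- **ADS15 Thm. 3.1 for a translation-invariant infinite-volume double current, without
ergodicity or uniqueness of the infinite cluster**: if `μ` is the local limit of the box double
currents at `β > 0` (`IsAdsLimit d β μ`), invariant under the lattice translations, and
`M̃_LRO(β) = 0`, then `μ[x ↔ ∞] = 0` for every `x` ("For `β` at which `M̃_LRO(β) = 0`, also
`ℙ_β[0 ↔ ∞] = 0`"). Proof: (S), Lemma 2.6 and (3.4), fed into the no-ergodicity density criterion
`measure_percolatesAt_eq_zero_of_insertionTolerant` (at most two infinite clusters by the
ergodicity-free half of Burton–Keane, and `(a+b)² ≤ 2(a²+b²)`). [cite: AizenmanDuminilCopinSidoraviciusCMP2015, Thm. 3.1] -/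
theorem percolatesAt_eq_zero (hβ : 0 < β) (hμ : IsAdsLimit d β μ)
    (hT : ∀ v : Site d, MeasurePreserving (BondConfig.relabel (sym2Equiv (Site.shift v))) μ μ)
    (hlro : lroTildeSq d β = 0) (x : Site d) : μ (percolatesAt x) = 0 := by
  haveI := hμ.isProbabilityMeasure
  rcases Nat.eq_zero_or_pos d with rfl | hd
  · -- `ℤ⁰` is a single site: no cluster is infinite
    have : percolatesAt x = (∅ : Set (BondConfig (Site 0))) :=
      Set.eq_empty_of_forall_notMem fun ω hω => hω (Set.toFinite _)
    rw [this, measure_empty]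
  -- block averages of `⟨σ_xσ_y⟩⁰_β` are arbitrarily small
  have hinf : ∀ ε : ℝ, 0 < ε → ∃ B : Finset (Site d), B.Nonempty ∧
      (∑ x ∈ B, ∑ y ∈ B, freePair d β x y) / (B.card : ℝ) ^ 2 < ε := by
    intro ε hε
    have hlt : sInf (freeBlockAverage d β '' {B : Finset (Site d) | B.Nonempty}) < ε := by
      rw [← lroTildeSq, hlro]; exact hε
    obtain ⟨a, ⟨B, hB, rfl⟩, ha⟩ := exists_lt_of_csInf_lt (lroTildeSq_set_nonempty d β) hlt
    exact ⟨B, hB, by rwa [freeBlockAverage_def] at ha⟩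
  exact measure_percolatesAt_eq_zero_of_insertionTolerant hd μ (hμ.ae_subset_edgeSet d hβ.le) hT
    (hμ.box_insertion hβ) (freePair d β) (hμ.openConn_le_freePair d hβ) hinf x

end IsAdsLimit

end Literature.Probability.LatticeModels

namespace Literature.Probability.LatticeModels

variable {d : ℕ}

/-- **ADS15 Thm. 3.1 from Thm. 2.3 (R2) alone**: the named fact
`ads_percolatesAt_zero_of_lroTildeSq` (`M̃_LRO(β) = 0 ⇒ ℙ_β[0 ↔ ∞] = 0`, `β > 0`) follows from
the shift invariance `ads_doubleCurrent_shift_invariant` of the infinite-volume double current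
(if the local limit does not exist, `ℙ_β` is the junk measure `0` and there is nothing to prove;
if it exists, apply `IsAdsLimit.percolatesAt_eq_zero`). Neither the existence R1 nor the
ergodicity R3 of ADS15 Thm. 2.3, nor the uniqueness Thm. 2.5, is used. [cite: AizenmanDuminilCopinSidoraviciusCMP2015, Thm. 3.1] -/
theorem ads_percolatesAt_zero_of_lroTildeSq_of_shift_invariant
    (hR2 : ads_doubleCurrent_shift_invariant (d := d)) :
    ads_percolatesAt_zero_of_lroTildeSq (d := d) := by
  intro β hβ hlro
  by_cases h : ∃ μ, IsAdsLimit d β μ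
  · exact (isAdsLimit_adsDoubleCurrentLawInf d h).percolatesAt_eq_zero hβ
      (measurePreserving_of_map_bondShift_eq d (hR2 hβ)) hlro 0
  · rw [adsDoubleCurrentLawInf, dif_neg h, Measure.coe_zero, Pi.zero_apply]

/-- **The exit probability vanishes, from R1 and R2** (ADS15 Thm. 2.3): the named fact
`ads_exitProb_tendsto_zero_of_lroTildeSq` of `DoubleCurrents.lean`
(`M̃_LRO(β) = 0 ⇒ limsup_L ℙ_{Λ_L,β}[x ↔ δ] = 0`) from the existence and the shift invariance of
the infinite-volume double current, Thm. 3.1 being supplied by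
`ads_percolatesAt_zero_of_lroTildeSq_of_shift_invariant`. [cite: AizenmanDuminilCopinSidoraviciusCMP2015, §3.2, remark after eq. (3.11)] -/
theorem ads_exitProb_tendsto_zero_of_lroTildeSq_of_limit
    (hR1 : ads_doubleCurrent_limit_exists (d := d))
    (hR2 : ads_doubleCurrent_shift_invariant (d := d)) :
    ads_exitProb_tendsto_zero_of_lroTildeSq (d := d) :=
  ads_exitProb_tendsto_zero_of_lroTildeSq_of_infinite hR1 hR2
    (ads_percolatesAt_zero_of_lroTildeSq_of_shift_invariant hR2)

/-- **`M̃_LRO(β) = 0 ⇒ ⟨σ_xσ_y⟩⁺_β = ⟨σ_xσ_y⟩⁰_β` from R1 and R2** (ADS15 §3.2, (3.10)–(3.11); the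
named fact `plusPair_eq_freePair_of_lroTildeSq` of `MagnetizationContinuity.lean`). [cite: AizenmanDuminilCopinSidoraviciusCMP2015, §3.2, eqs. (3.10)–(3.11)] -/
theorem plusPair_eq_freePair_of_lroTildeSq_of_limit
    (hR1 : ads_doubleCurrent_limit_exists (d := d))
    (hR2 : ads_doubleCurrent_shift_invariant (d := d)) :
    plusPair_eq_freePair_of_lroTildeSq (d := d) :=
  plusPair_eq_freePair_of_lroTildeSq_of_exitProb (ads_exitProb_tendsto_zero_of_lroTildeSq_of_limit hR1 hR2)

/-- **`m*(β_c) = 0` (`d ≥ 3`) from R1, R2 and the classical inputs** (existence of the plus state,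
the infrared bound, `β_c > 0`): the tree's
`spontaneousMagnetization_criticalBeta_eq_zero_of_infiniteCurrents` with its hypothesis Thm. 3.1
discharged by `ads_percolatesAt_zero_of_lroTildeSq_of_shift_invariant`. [cite: AizenmanDuminilCopinSidoraviciusCMP2015, Thm. 1.2 with Cor. 1.5] -/
theorem spontaneousMagnetization_criticalBeta_eq_zero_of_limit
    (hR1 : ads_doubleCurrent_limit_exists (d := d))
    (hR2 : ads_doubleCurrent_shift_invariant (d := d))
    (hplus : ∀ β : ℝ, exists_plusMeasure d (β := β) 0)
    (hIR : ∀ (L : ℕ) [NeZero L], infraredBound (d := d) (L := L))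
    (hβc : criticalBeta_pos (d := d)) :
    spontaneousMagnetization_criticalBeta_eq_zero (d := d) :=
  spontaneousMagnetization_criticalBeta_eq_zero_of_infiniteCurrents hR1 hR2
    (ads_percolatesAt_zero_of_lroTildeSq_of_shift_invariant hR2) hplus hIR hβc

end Literature.Probability.LatticeModels
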